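import Summits.ResolutionOfSingularities.ResolutionOfSingularities.Theorems.FrobeniusLadderFInjectiveMacaulayficationPencilExitTagCode1
import HarnessLib

/-!
# TASK 4b SOUNDNESS, code 1 in the TWO-UNIT case `r|_Z = s|_Z = 0` at the points with `χ(c) = c^r − c^s ≠ 0` (frequent on the Ω₁ cure fans: orbits through rays with `2α = 3β`);
# the same `Θ`-witness as ✓p696956, the constant term of `Θ(χ)` now being `χ(c)` itself
# (crux `FInjectiveMacaulayfication` stmt-ResolutionOfSingularities-15315, chain w45a; RULING R23.2 (2); consumer res-L1-w45a-stub-3 TASK 4c; seat res-L1-w45a-stub-1 g14)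

[OURS · L1 W4.5a] Support file (`--supports stmt-ResolutionOfSingularities-15315 --as helper`); theorems only; unconditional; any field, every prime `p`. Nothing of the crux is proved;
no census row is asserted. AI-written (AI review is weaker than expert review).
* §1 ★★ `fullCl_pencilChartW_code1_twoUnit`, §2 ★★ `fullCl_pencilChartU_pole_code1_twoUnit` — hypotheses `hr0 : r|_Z = 0`, `hs0 : s|_Z = 0`, `hχ : eval c (y^r − y^s) ≠ 0`, `M₂|_Z ≤ 1`,
  `M₁ ⊥ M₂`, `Φ` prime (✓ `PencilPhiPrime.prime_pencilPhiW`). The complementary points `χ(c) = 0` (the strict transform of the cusp) need the transversal parameter `y_{i₁} − c_{i₁}` with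
  `p ∤ (r_{i₁} − s_{i₁})` — NOT in this file.
[cite: Fedder1983, Thm. 1.12]
-/

set_option linter.dupNamespace false

noncomputable section

open AlgebraicGeometry IsLocalRing MvPolynomial
open scoped Pointwise

namespace Summit.ResolutionOfSingularities.ResolutionOfSingularities.Theorems.FInjectiveMacaulayfication.PencilExitTagCode1TwoUnit

open Summit.ResolutionOfSingularities.ResolutionOfSingularities.Theorems.FInjectiveMacaulayfication
open SliceableCentre PencilExitTagW PencilExitTagCode1

variable (k : Type) [Field k] {n : ℕ}

/-! ## §1 ★★ The `W`-chart -/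

set_option maxHeartbeats 1600000 in
-- one long polynomial bookkeeping proof
/-- ★★ **CODE 1 («pencil, j = 0»): the `W`-chart `V(Φ_W)`, `Φ_W = (y^{M₁})⁺·W − (y^{M₂}(y^r − y^s))⁺`, is FULL at every closed point `(w₀; c)` with `M₂ i ≤ 1` on `Z = {c = 0}`, in the
TWO-UNIT case `r|_Z = s|_Z = 0` at a point where `χ(c) = c^r − c^s ≠ 0`** (`M₁ ⊥ M₂`; every prime `p`). [OURS · TASK 4b soundness; cite: Fedder1983, Thm. 1.12] -/
theorem fullCl_pencilChartW_code1_twoUnit (p : ℕ) [Fact p.Prime] [CharP k p] (M₁ M₂ r s : Fin n →₀ ℕ) (hdisj : ∀ i, M₁ i = 0 ∨ M₂ i = 0)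
    (Φ : MvPolynomial (Fin (n + 1)) k)
    (hΦ : Φ = rename Fin.succ (monomial M₁ (1 : k)) * X 0 - rename Fin.succ (monomial M₂ (1 : k) * (monomial r 1 - monomial s 1))) (hΦp : Prime Φ)
    (c : Fin n → k) (w₀ : k) (y : Spec (.of (MvPolynomial (Fin (n + 1)) k ⧸ Ideal.span {Φ}))) (hy : y.asIdeal.IsMaximal)
    (ha : y.asIdeal.comap (Ideal.Quotient.mk (Ideal.span {Φ})) =
      Ideal.span (Set.range (Fin.cons ((X 0 : MvPolynomial (Fin (n + 1)) k) - C w₀) fun i : Fin n => X i.succ - C (c i))))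
    (hM₂ : ∀ i, c i = 0 → M₂ i ≤ 1)
    (hr0 : ∀ i, c i = 0 → r i = 0) (hs0 : ∀ i, c i = 0 → s i = 0) (hχ : eval c (monomial r (1 : k) - monomial s 1) ≠ 0) :
    FullCl p ((Spec (.of (MvPolynomial (Fin (n + 1)) k ⧸ Ideal.span {Φ}))).presheaf.stalk y) := by
  classical
  -- if `M₁|_Z ≤ 1` this is the `W^{p−1}` witness
  by_cases hM₁ : ∀ i, c i = 0 → M₁ i ≤ 1
  · exact fullCl_pencilChartW_of_M₁_le_one k p M₁ _ Φ hΦ hΦp c w₀ y hy ha hM₁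
  push Not at hM₁
  obtain ⟨i₀, hci₀, hM₁i₀⟩ := hM₁
  have hM₁i₀' : M₁ i₀ ≠ 0 := by omega
  have hM₂i₀ : M₂ i₀ = 0 := (hdisj i₀).resolve_left hM₁i₀'
  have hp1 : 1 ≤ p := (Fact.out : p.Prime).one_lt.le
  -- the substitutions
  set v₀ : Fin n → MvPolynomial (Fin n) k := fun i => if c i = 0 then X i else C (c i) with hv₀
  set θ₀ : MvPolynomial (Fin n) k →ₐ[k] MvPolynomial (Fin n) k := aeval v₀ with hθ₀
  set π : MvPolynomial (Fin n) k →ₐ[k] MvPolynomial (Fin n) k := aeval (fun i : Fin n => if i = i₀ then (0 : MvPolynomial (Fin n) k) else X i) with hπ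
  set Θ : MvPolynomial (Fin (n + 1)) k →ₐ[k] MvPolynomial (Fin (n + 1)) k :=
    aeval (Fin.cons (X 0 + C w₀) fun i : Fin n => rename Fin.succ (π (v₀ i))) with hΘ
  have hΘX0 : Θ (X 0) = X 0 + C w₀ := by rw [hΘ, aeval_X, Fin.cons_zero]
  have hΘsucc : ∀ q : MvPolynomial (Fin n) k, Θ (rename Fin.succ q) = rename Fin.succ (π (θ₀ q)) := by
    intro q
    rw [hΘ, aeval_rename, hθ₀, ← AlgHom.comp_apply, ← AlgHom.comp_apply]
    congr 1
    refine MvPolynomial.algHom_ext fun i => ?_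
    rw [AlgHom.comp_apply, AlgHom.comp_apply, aeval_X, aeval_X, Function.comp_apply, Fin.cons_succ]
  -- `θ₀` and `π` on the three monomials
  have hθ₀m : ∀ M : Fin n →₀ ℕ, θ₀ (monomial M 1) = C (∏ i ∈ M.support with c i ≠ 0, c i ^ M i) * monomial (M.filter fun i => c i = 0) 1 := fun M => by
    rw [hθ₀, hv₀, theta0_monomial]
  have hπA : π (θ₀ (monomial M₁ 1)) = 0 := by
    rw [hθ₀m, map_mul, hπ, kill_monomial, if_neg (by rw [Finsupp.filter_apply_pos (fun i => c i = 0) M₁ hci₀]; exact hM₁i₀'), mul_zero]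
  have hπM₂ : π (monomial (M₂.filter fun i => c i = 0) (1 : k)) = monomial (M₂.filter fun i => c i = 0) 1 := by
    rw [hπ, kill_monomial, if_pos (by rw [Finsupp.filter_apply_pos (fun i => c i = 0) M₂ hci₀]; exact hM₂i₀)]
  set β : k := ∏ i ∈ M₂.support with c i ≠ 0, c i ^ M₂ i with hβ
  set ρ : k := ∏ i ∈ r.support with c i ≠ 0, c i ^ r i with hρ
  set σ : k := ∏ i ∈ s.support with c i ≠ 0, c i ^ s i with hσ
  have hβ0 : β ≠ 0 := theta0_scalar_ne_zero k c M₂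
  have hρ0 : ρ ≠ 0 := theta0_scalar_ne_zero k c r
  have hσ0 : σ ≠ 0 := theta0_scalar_ne_zero k c s
  set ψ : MvPolynomial (Fin n) k := C ρ * π (monomial (r.filter fun i => c i = 0) 1) - C σ * π (monomial (s.filter fun i => c i = 0) 1) with hψ
  have hΘB : π (θ₀ (monomial M₂ (1 : k) * (monomial r 1 - monomial s 1))) = C β * monomial (M₂.filter fun i => c i = 0) 1 * ψ := by
    rw [map_mul, map_sub, hθ₀m, hθ₀m, hθ₀m, map_mul, map_sub, map_mul, map_mul, map_mul, hπM₂, hψ, hπ, aeval_C, aeval_C, aeval_C, algebraMap_eq]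
  have hΘΦ : Θ Φ = rename Fin.succ (-(C β * monomial (M₂.filter fun i => c i = 0) 1 * ψ)) := by
    rw [hΦ, map_sub, map_mul, hΘsucc, hΘsucc, hπA, map_zero, zero_mul, zero_sub, hΘB, map_neg]
  -- the constant term of `ψ` is `χ(c) ≠ 0`
  have hψ0 : constantCoeff ψ ≠ 0 := by
    have hfilt : ∀ v : Fin n →₀ ℕ, (∀ i, c i = 0 → v i = 0) → (v.filter fun i => c i = 0) = 0 := fun v hv => by
      ext i; by_cases hci : c i = 0
      · rw [Finsupp.filter_apply_pos (fun i => c i = 0) v hci, hv i hci]; rfl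
      · rw [Finsupp.filter_apply_neg (fun i => c i = 0) v hci]; rfl
    have hprod : ∀ v : Fin n →₀ ℕ, (∀ i, c i = 0 → v i = 0) → (∏ i ∈ v.support with c i ≠ 0, c i ^ v i) = eval c (monomial v (1 : k)) := fun v hv => by
      have hF : Finset.filter (fun i => c i ≠ 0) v.support = v.support :=
        Finset.filter_eq_self.2 fun i hi hci => (Finsupp.mem_support_iff.1 hi) (hv i hci)
      rw [eval_monomial, one_mul, Finsupp.prod, hF]
    rw [hψ, map_sub, map_mul, map_mul, constantCoeff_C, constantCoeff_C, hπ, constantCoeff_kill_monomial, constantCoeff_kill_monomial, hfilt r hr0, hfilt s hs0,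
      if_pos rfl, mul_one, mul_one, hρ, hσ, hprod r hr0, hprod s hs0, ← map_sub]
    exact hχ
  -- the witness monomial `y^{(p−1) M₂|_Z}` (no `W`)
  set d₀ : Fin n →₀ ℕ := (p - 1) • M₂.filter fun i => c i = 0 with hd₀
  have hcoeff : coeff (Finsupp.cons 0 d₀) (Θ Φ ^ (p - 1)) = (-1) ^ (p - 1) * β ^ (p - 1) * constantCoeff ψ ^ (p - 1) := by
    rw [hΘΦ, ← map_pow, coeff_cons_zero_rename_succ, neg_pow, mul_pow, mul_pow, ← map_pow, monomial_pow, one_pow, ← hd₀,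
      show ((-1 : MvPolynomial (Fin n) k) ^ (p - 1)) = C ((-1 : k) ^ (p - 1)) by rw [map_pow, map_neg, map_one], ← mul_assoc, ← mul_assoc, ← map_mul, mul_assoc, coeff_C_mul,
      coeff_monomial_mul', if_pos le_rfl, tsub_self, one_mul, ← constantCoeff_eq, map_pow, mul_assoc]
  have hd : Finsupp.cons 0 d₀ ∈ ((Θ : MvPolynomial (Fin (n + 1)) k →+* MvPolynomial (Fin (n + 1)) k) Φ ^ (p - 1)).support := by
    rw [mem_support_iff, RingHom.coe_coe, hcoeff]
    exact mul_ne_zero (mul_ne_zero (pow_ne_zero _ (neg_ne_zero.2 one_ne_zero)) (pow_ne_zero _ hβ0)) (pow_ne_zero _ hψ0)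
  -- conclude by the reduction
  refine PencilExitSoundnessKit.hypersurface_fullCl_stalk_of_reduction k p Φ hΦp _ y hy ha (Θ : MvPolynomial (Fin (n + 1)) k →+* MvPolynomial (Fin (n + 1)) k)
    ({0} ∪ Set.range fun i : {i : Fin n // c i = 0} => (i.1.succ : Fin (n + 1))) (fun j => ?_) _ hd (fun j hj => ?_)
  · refine Fin.cases ?_ (fun i => ?_) j
    · right
      refine ⟨0, Set.mem_union_left _ rfl, ?_⟩
      rw [Fin.cons_zero, RingHom.coe_coe, map_sub, hΘX0, hΘ, aeval_C, algebraMap_eq]; ring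
    · have hΘi : Θ (X i.succ) = rename Fin.succ (π (v₀ i)) := by rw [hΘ, aeval_X, Fin.cons_succ]
      by_cases hci : c i = 0
      · by_cases hii : i = i₀
        · left
          rw [Fin.cons_succ, RingHom.coe_coe, map_sub, hΘi, hv₀]; dsimp only
          rw [if_pos hci, hπ, aeval_X, if_pos hii, map_zero, hΘ, aeval_C, algebraMap_eq, hci, C_0, sub_zero]
        · right
          refine ⟨i.succ, Set.mem_union_right _ ⟨⟨i, hci⟩, rfl⟩, ?_⟩
          rw [Fin.cons_succ, RingHom.coe_coe, map_sub, hΘi, hv₀]; dsimp only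
          rw [if_pos hci, hπ, aeval_X, if_neg hii, rename_X, hΘ, aeval_C, algebraMap_eq, hci, C_0, sub_zero]
      · left
        rw [Fin.cons_succ, RingHom.coe_coe, map_sub, hΘi, hv₀]; dsimp only
        rw [if_neg hci, hπ, aeval_C, algebraMap_eq, rename_C, hΘ, aeval_C, algebraMap_eq, sub_self]
  · rcases hj with hj | ⟨⟨i, hci⟩, rfl⟩
    · rw [Set.mem_singleton_iff] at hj; subst hj
      rw [Finsupp.cons_zero]; omega
    · rw [Finsupp.cons_succ, hd₀, Finsupp.smul_apply, Finsupp.filter_apply_pos (fun i => c i = 0) M₂ hci, smul_eq_mul]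
      have := hM₂ i hci
      calc (p - 1) * M₂ i ≤ (p - 1) * 1 := Nat.mul_le_mul_left _ this
        _ < p := by omega

/-! ## §2 ★★ The pole `U = 0` -/

set_option maxHeartbeats 1600000 in
-- one long polynomial bookkeeping proof
/-- ★★ **CODE 1 AT THE POLE**: the `U`-chart `V(Φ_U)`, `Φ_U = (y^{M₂}(y^r − y^s))⁺·U − (y^{M₁})⁺`, is FULL at every closed point `(0; c)` of `U = 0` in the two-unit case (`M₂ i ≤ 1` on
`Z`, `r|_Z = s|_Z = 0`, `χ(c) ≠ 0`, `M₁ ⊥ M₂`; every prime `p`). Witness: after killing a letter `y_{i₀}` with `M₁ i₀ ≥ 1`, `Θ(Φ_U) = (β·y^{M₂|_Z}·ψ)⁺·U` and the monomial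
`U^{p−1}·y^{(p−1)M₂|_Z}`; if `M₁|_Z ≤ 1`, ✓p696598 `fullCl_pencilChartU_pole_of_M₁_le_one`. [OURS · TASK 4b soundness; cite: Fedder1983, Thm. 1.12] -/
theorem fullCl_pencilChartU_pole_code1_twoUnit (p : ℕ) [Fact p.Prime] [CharP k p] (M₁ M₂ r s : Fin n →₀ ℕ) (hdisj : ∀ i, M₁ i = 0 ∨ M₂ i = 0)
    (Φ : MvPolynomial (Fin (n + 1)) k)
    (hΦ : Φ = rename Fin.succ (monomial M₂ (1 : k) * (monomial r 1 - monomial s 1)) * X 0 - rename Fin.succ (monomial M₁ (1 : k))) (hΦp : Prime Φ)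
    (c : Fin n → k) (y : Spec (.of (MvPolynomial (Fin (n + 1)) k ⧸ Ideal.span {Φ}))) (hy : y.asIdeal.IsMaximal)
    (ha : y.asIdeal.comap (Ideal.Quotient.mk (Ideal.span {Φ})) =
      Ideal.span (Set.range (Fin.cons (X 0 : MvPolynomial (Fin (n + 1)) k) fun i : Fin n => X i.succ - C (c i))))
    (hM₂ : ∀ i, c i = 0 → M₂ i ≤ 1)
    (hr0 : ∀ i, c i = 0 → r i = 0) (hs0 : ∀ i, c i = 0 → s i = 0) (hχ : eval c (monomial r (1 : k) - monomial s 1) ≠ 0) :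
    FullCl p ((Spec (.of (MvPolynomial (Fin (n + 1)) k ⧸ Ideal.span {Φ}))).presheaf.stalk y) := by
  classical
  by_cases hM₁ : ∀ i, c i = 0 → M₁ i ≤ 1
  · exact fullCl_pencilChartU_pole_of_M₁_le_one k p M₁ _ Φ hΦ hΦp c y hy ha hM₁
  push Not at hM₁
  obtain ⟨i₀, hci₀, hM₁i₀⟩ := hM₁
  have hM₁i₀' : M₁ i₀ ≠ 0 := by omega
  have hM₂i₀ : M₂ i₀ = 0 := (hdisj i₀).resolve_left hM₁i₀'
  have hp1 : 1 ≤ p := (Fact.out : p.Prime).one_lt.le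
  -- the substitutions (no shift of `U`)
  set v₀ : Fin n → MvPolynomial (Fin n) k := fun i => if c i = 0 then X i else C (c i) with hv₀
  set θ₀ : MvPolynomial (Fin n) k →ₐ[k] MvPolynomial (Fin n) k := aeval v₀ with hθ₀
  set π : MvPolynomial (Fin n) k →ₐ[k] MvPolynomial (Fin n) k := aeval (fun i : Fin n => if i = i₀ then (0 : MvPolynomial (Fin n) k) else X i) with hπ
  set Θ : MvPolynomial (Fin (n + 1)) k →ₐ[k] MvPolynomial (Fin (n + 1)) k :=
    aeval (Fin.cons (X 0) fun i : Fin n => rename Fin.succ (π (v₀ i))) with hΘ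
  have hΘX0 : Θ (X 0) = X 0 := by rw [hΘ, aeval_X, Fin.cons_zero]
  have hΘsucc : ∀ q : MvPolynomial (Fin n) k, Θ (rename Fin.succ q) = rename Fin.succ (π (θ₀ q)) := by
    intro q
    rw [hΘ, aeval_rename, hθ₀, ← AlgHom.comp_apply, ← AlgHom.comp_apply]
    congr 1
    refine MvPolynomial.algHom_ext fun i => ?_
    rw [AlgHom.comp_apply, AlgHom.comp_apply, aeval_X, aeval_X, Function.comp_apply, Fin.cons_succ]
  have hθ₀m : ∀ M : Fin n →₀ ℕ, θ₀ (monomial M 1) = C (∏ i ∈ M.support with c i ≠ 0, c i ^ M i) * monomial (M.filter fun i => c i = 0) 1 := fun M => by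
    rw [hθ₀, hv₀, theta0_monomial]
  have hπA : π (θ₀ (monomial M₁ 1)) = 0 := by
    rw [hθ₀m, map_mul, hπ, kill_monomial, if_neg (by rw [Finsupp.filter_apply_pos (fun i => c i = 0) M₁ hci₀]; exact hM₁i₀'), mul_zero]
  have hπM₂ : π (monomial (M₂.filter fun i => c i = 0) (1 : k)) = monomial (M₂.filter fun i => c i = 0) 1 := by
    rw [hπ, kill_monomial, if_pos (by rw [Finsupp.filter_apply_pos (fun i => c i = 0) M₂ hci₀]; exact hM₂i₀)]
  set β : k := ∏ i ∈ M₂.support with c i ≠ 0, c i ^ M₂ i with hβ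
  set ρ : k := ∏ i ∈ r.support with c i ≠ 0, c i ^ r i with hρ
  set σ : k := ∏ i ∈ s.support with c i ≠ 0, c i ^ s i with hσ
  have hβ0 : β ≠ 0 := theta0_scalar_ne_zero k c M₂
  have hρ0 : ρ ≠ 0 := theta0_scalar_ne_zero k c r
  have hσ0 : σ ≠ 0 := theta0_scalar_ne_zero k c s
  set ψ : MvPolynomial (Fin n) k := C ρ * π (monomial (r.filter fun i => c i = 0) 1) - C σ * π (monomial (s.filter fun i => c i = 0) 1) with hψ
  have hΘB : π (θ₀ (monomial M₂ (1 : k) * (monomial r 1 - monomial s 1))) = C β * monomial (M₂.filter fun i => c i = 0) 1 * ψ := by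
    rw [map_mul, map_sub, hθ₀m, hθ₀m, hθ₀m, map_mul, map_sub, map_mul, map_mul, map_mul, hπM₂, hψ, hπ, aeval_C, aeval_C, aeval_C, algebraMap_eq]
  have hΘΦ : Θ Φ = rename Fin.succ (C β * monomial (M₂.filter fun i => c i = 0) 1 * ψ) * X 0 := by
    rw [hΦ, map_sub, map_mul, hΘsucc, hΘsucc, hπA, hΘB, hΘX0, map_zero, sub_zero]
  -- the constant term of `ψ` is `χ(c) ≠ 0`
  have hψ0 : constantCoeff ψ ≠ 0 := by
    have hfilt : ∀ v : Fin n →₀ ℕ, (∀ i, c i = 0 → v i = 0) → (v.filter fun i => c i = 0) = 0 := fun v hv => by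
      ext i; by_cases hci : c i = 0
      · rw [Finsupp.filter_apply_pos (fun i => c i = 0) v hci, hv i hci]; rfl
      · rw [Finsupp.filter_apply_neg (fun i => c i = 0) v hci]; rfl
    have hprod : ∀ v : Fin n →₀ ℕ, (∀ i, c i = 0 → v i = 0) → (∏ i ∈ v.support with c i ≠ 0, c i ^ v i) = eval c (monomial v (1 : k)) := fun v hv => by
      have hF : Finset.filter (fun i => c i ≠ 0) v.support = v.support :=
        Finset.filter_eq_self.2 fun i hi hci => (Finsupp.mem_support_iff.1 hi) (hv i hci)
      rw [eval_monomial, one_mul, Finsupp.prod, hF]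
    rw [hψ, map_sub, map_mul, map_mul, constantCoeff_C, constantCoeff_C, hπ, constantCoeff_kill_monomial, constantCoeff_kill_monomial, hfilt r hr0, hfilt s hs0,
      if_pos rfl, mul_one, mul_one, hρ, hσ, hprod r hr0, hprod s hs0, ← map_sub]
    exact hχ
  -- in `k[y][U]`: the `U^{p−1}` coefficient
  have hfs : finSuccEquiv k n (Θ Φ) = Polynomial.C (C β * monomial (M₂.filter fun i => c i = 0) 1 * ψ) * Polynomial.X + Polynomial.C 0 := by
    rw [hΘΦ, map_mul, PencilIntegral.finSuccEquiv_rename_succ, finSuccEquiv_X_zero, map_zero, add_zero]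
  have hq0 : (C β * monomial (M₂.filter fun i => c i = 0) (1 : k) * ψ) ≠ 0 := by
    refine mul_ne_zero (mul_ne_zero (by rwa [Ne, C_eq_zero]) (by rw [Ne, monomial_eq_zero]; exact one_ne_zero)) fun h => hψ0 ?_
    rw [h, map_zero]
  have hlead : ((finSuccEquiv k n (Θ Φ)) ^ (p - 1)).coeff (p - 1) = (C β * monomial (M₂.filter fun i => c i = 0) (1 : k) * ψ) ^ (p - 1) := by
    rw [hfs]
    have hdeg := Polynomial.natDegree_linear (b := (0 : MvPolynomial (Fin n) k)) hq0
    have hlc := Polynomial.leadingCoeff_linear (b := (0 : MvPolynomial (Fin n) k)) hq0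
    have h1 : ((Polynomial.C (C β * monomial (M₂.filter fun i => c i = 0) (1 : k) * ψ) * Polynomial.X + Polynomial.C 0) ^ (p - 1)).natDegree = p - 1 := by
      rw [Polynomial.natDegree_pow, hdeg, mul_one]
    have h2 := Polynomial.coeff_natDegree (p := (Polynomial.C (C β * monomial (M₂.filter fun i => c i = 0) (1 : k) * ψ) * Polynomial.X + Polynomial.C 0) ^ (p - 1))
    rw [h1] at h2
    rw [h2, Polynomial.leadingCoeff_pow, hlc]
  set d₀ : Fin n →₀ ℕ := (p - 1) • M₂.filter fun i => c i = 0 with hd₀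
  have hcoeff : coeff (Finsupp.cons (p - 1) d₀) (Θ Φ ^ (p - 1)) = β ^ (p - 1) * constantCoeff ψ ^ (p - 1) := by
    rw [← finSuccEquiv_coeff_coeff, map_pow, hlead, mul_pow, mul_pow, ← map_pow, monomial_pow, one_pow, ← hd₀, mul_assoc, coeff_C_mul,
      coeff_monomial_mul', if_pos le_rfl, tsub_self, one_mul, ← constantCoeff_eq, map_pow]
  have hd : Finsupp.cons (p - 1) d₀ ∈ ((Θ : MvPolynomial (Fin (n + 1)) k →+* MvPolynomial (Fin (n + 1)) k) Φ ^ (p - 1)).support := by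
    rw [mem_support_iff, RingHom.coe_coe, hcoeff]
    exact mul_ne_zero (pow_ne_zero _ hβ0) (pow_ne_zero _ hψ0)
  refine PencilExitSoundnessKit.hypersurface_fullCl_stalk_of_reduction k p Φ hΦp _ y hy ha (Θ : MvPolynomial (Fin (n + 1)) k →+* MvPolynomial (Fin (n + 1)) k)
    ({0} ∪ Set.range fun i : {i : Fin n // c i = 0} => (i.1.succ : Fin (n + 1))) (fun j => ?_) _ hd (fun j hj => ?_)
  · refine Fin.cases ?_ (fun i => ?_) j
    · right
      exact ⟨0, Set.mem_union_left _ rfl, by rw [Fin.cons_zero, RingHom.coe_coe, hΘX0]⟩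
    · have hΘi : Θ (X i.succ) = rename Fin.succ (π (v₀ i)) := by rw [hΘ, aeval_X, Fin.cons_succ]
      by_cases hci : c i = 0
      · by_cases hii : i = i₀
        · left
          rw [Fin.cons_succ, RingHom.coe_coe, map_sub, hΘi, hv₀]; dsimp only
          rw [if_pos hci, hπ, aeval_X, if_pos hii, map_zero, hΘ, aeval_C, algebraMap_eq, hci, C_0, sub_zero]
        · right
          refine ⟨i.succ, Set.mem_union_right _ ⟨⟨i, hci⟩, rfl⟩, ?_⟩
          rw [Fin.cons_succ, RingHom.coe_coe, map_sub, hΘi, hv₀]; dsimp only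
          rw [if_pos hci, hπ, aeval_X, if_neg hii, rename_X, hΘ, aeval_C, algebraMap_eq, hci, C_0, sub_zero]
      · left
        rw [Fin.cons_succ, RingHom.coe_coe, map_sub, hΘi, hv₀]; dsimp only
        rw [if_neg hci, hπ, aeval_C, algebraMap_eq, rename_C, hΘ, aeval_C, algebraMap_eq, sub_self]
  · rcases hj with hj | ⟨⟨i, hci⟩, rfl⟩
    · rw [Set.mem_singleton_iff] at hj; subst hj
      rw [Finsupp.cons_zero]; omega
    · rw [Finsupp.cons_succ, hd₀, Finsupp.smul_apply, Finsupp.filter_apply_pos (fun i => c i = 0) M₂ hci, smul_eq_mul]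
      have := hM₂ i hci
      calc (p - 1) * M₂ i ≤ (p - 1) * 1 := Nat.mul_le_mul_left _ this
        _ < p := by omega

end Summit.ResolutionOfSingularities.ResolutionOfSingularities.Theorems.FInjectiveMacaulayfication.PencilExitTagCode1TwoUnit

end
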